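import Mathlib
import HarnessLib
import Summits.SmoothPoincare4.SmoothPoincare4.Theses.ConvexBisection
import Literature.Topology.FourManifolds.Gluing
import Literature.Topology.FourManifolds.Corks
import Literature.Geometry.Symplectic.SteinDomain
import Literature.Geometry.Symplectic.SteinBoundaryContact
import Literature.Geometry.Symplectic.PlanarContactBoundary

/-!
# Sketch — crux-ideate stmt-SmoothPoincare4-3546 (ContractibleTwistedDoubleStandard), ideator 3, round 1

First lemmas of the two idea cards `Ideas/cap-transplant-rigid-rational-cap.md` (card A) and
`Ideas/planar-gram-rigidity.md` (card B).  Nothing here is proved; every `def … : Prop` only has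
to elaborate.  All constants were checked with `lean search --decl`:
`Literature.Topology.FourManifolds.BoundaryData`, `….IsBoundaryGluing`, `….IsDouble`,
`….ExtendsToDiffeomorph`, `Literature.Geometry.Symplectic.SteinStructure`,
`Literature.Geometry.Symplectic.contactPlane`, `Literature.Geometry.Symplectic.PlanarContactBoundary`.
-/

open scoped Manifold ContDiff Matrix
open Literature.Topology.FourManifolds Literature.Geometry.Symplectic

noncomputable section

namespace Summit.SmoothPoincare4.SmoothPoincare4.Cruxes.ContractibleTwistedDoubleStandard.Sketch

/-- Local notation: the round 4-sphere. -/
local notation "𝕊⁴" => (Metric.sphere (0 : EuclideanSpace ℝ (Fin 5)) 1)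

/-! ## Card A — cap transplant -/

/-- **Transplant identity (card A, first lemma; provable now, pure gluing bookkeeping).**
If `X = W₁ ∪_ψ W₂` along the boundary and `a : W₁ ≃ W₂` is a diffeomorphism whose boundary trace
is `ψ ∘ g⁻¹… ` — precisely `a (ι₁ (g z)) = ι₂ (ψ z)` — then `X` is also the SELF-gluing
`W₁ ∪_g W₁`.  In the card, `a` is the restriction to the filling of a symplectomorphism of the
capped rational surfaces `W₁ ∪ K ≅ W₂ ∪ K` preserving the cap `K`, and `g` is the boundary trace
of the induced cap automorphism. -/
def TransplantToSelfGluing : Prop :=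
  ∀ (W₁ : Type) [TopologicalSpace W₁] [ChartedSpace (EuclideanHalfSpace 4) W₁]
    [IsManifold (𝓡∂ 4) ∞ W₁]
    (W₂ : Type) [TopologicalSpace W₂] [ChartedSpace (EuclideanHalfSpace 4) W₂]
    [IsManifold (𝓡∂ 4) ∞ W₂]
    (X : Type) [TopologicalSpace X] [ChartedSpace (EuclideanSpace ℝ (Fin 4)) X]
    [IsManifold (𝓡 4) ∞ X]
    (b₁ : BoundaryData (𝓡∂ 4) W₁ (𝓡 3)) (b₂ : BoundaryData (𝓡∂ 4) W₂ (𝓡 3))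
    (ψ : b₁.carrier ≃ₘ⟮𝓡 3, 𝓡 3⟯ b₂.carrier),
    IsBoundaryGluing b₁ b₂ ψ (𝓡 4) X →
    ∀ (a : W₁ ≃ₘ⟮𝓡∂ 4, 𝓡∂ 4⟯ W₂) (g : b₁.carrier ≃ₘ⟮𝓡 3, 𝓡 3⟯ b₁.carrier),
      (∀ z, a (b₁.incl (g z)) = b₂.incl (ψ z)) →
      IsBoundaryGluing b₁ b₁ g (𝓡 4) X

/-- The contact structure of a Stein domain read on an abstract boundary datum `b`: the pull-back
of the complex tangencies `contactPlane J` along `dι`. -/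
def seamPlane {W : Type} [TopologicalSpace W] [ChartedSpace (EuclideanHalfSpace 4) W]
    [IsManifold (𝓡∂ 4) ∞ W] [CompactSpace W] (J : SteinStructure W)
    (b : BoundaryData (𝓡∂ 4) W (𝓡 3)) (z : b.carrier) :
    Submodule ℝ (EuclideanSpace ℝ (Fin 3)) :=
  Submodule.comap (mfderiv (𝓡 3) (𝓡∂ 4) b.incl z).toLinearMap (contactPlane J.J (b.incl z))

/-- `g : ∂W → ∂W` carries the contact structure induced by `J` to the one induced by `J'`
(plane fields, no co-orientation — exactly as in the crux). -/
def IsSeamContacto {W : Type} [TopologicalSpace W] [ChartedSpace (EuclideanHalfSpace 4) W]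
    [IsManifold (𝓡∂ 4) ∞ W] [CompactSpace W] (J J' : SteinStructure W)
    (b : BoundaryData (𝓡∂ 4) W (𝓡 3)) (g : b.carrier ≃ₘ⟮𝓡 3, 𝓡 3⟯ b.carrier) : Prop :=
  ∀ z, Submodule.map (mfderiv (𝓡 3) (𝓡 3) g z).toLinearMap (seamPlane J b z) =
    seamPlane J' b (g z)

/-- **Residual target of card A (the "cap-symmetry sector").**  Self-gluings `W ∪_g W` of ONE
compact contractible Stein domain by a contactomorphism `g` between two Stein-induced contact
structures are `S⁴`.  (By `TransplantToSelfGluing` and the cap-transplant lemma of the card,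
the crux for rigidly capped seams reduces to this with `g` ranging over the finite list of cap
symmetries; `g = id` is the doubles sector `SteinDoubleStandard`.) -/
def CapSymmetryTwistStandard : Prop :=
  ∀ (W : Type) [TopologicalSpace W] [T2Space W] [SecondCountableTopology W]
    [ChartedSpace (EuclideanHalfSpace 4) W] [IsManifold (𝓡∂ 4) ∞ W] [CompactSpace W]
    [ContractibleSpace W] (J J' : SteinStructure W) (b : BoundaryData (𝓡∂ 4) W (𝓡 3))
    (g : b.carrier ≃ₘ⟮𝓡 3, 𝓡 3⟯ b.carrier), IsSeamContacto J J' b g →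
    ∀ (X : Type) [TopologicalSpace X] [T2Space X] [SecondCountableTopology X] [CompactSpace X]
      [ChartedSpace (EuclideanSpace ℝ (Fin 4)) X] [IsManifold (𝓡 4) ∞ X],
      IsBoundaryGluing b b g (𝓡 4) X → Nonempty (X ≃ₘ⟮𝓡 4, 𝓡 4⟯ 𝕊⁴)

/-- **Doubles sector** (`g = id`): the double of a compact contractible Stein domain is `S⁴`. -/
def SteinDoubleStandard : Prop :=
  ∀ (W : Type) [TopologicalSpace W] [T2Space W] [SecondCountableTopology W]
    [ChartedSpace (EuclideanHalfSpace 4) W] [IsManifold (𝓡∂ 4) ∞ W] [CompactSpace W]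
    [ContractibleSpace W] (_J : SteinStructure W) (b : BoundaryData (𝓡∂ 4) W (𝓡 3))
    (X : Type) [TopologicalSpace X] [T2Space X] [SecondCountableTopology X] [CompactSpace X]
    [ChartedSpace (EuclideanSpace ℝ (Fin 4)) X] [IsManifold (𝓡 4) ∞ X],
    IsDouble b (𝓡 4) X → Nonempty (X ≃ₘ⟮𝓡 4, 𝓡 4⟯ 𝕊⁴)

/-- **Extension kills the twist** (card A/B common bookkeeping, provable now from
`IsBoundaryGluing.isDouble_of_extends`): if the contact regluing `g` extends over `W`, the
self-gluing is a double, so `SteinDoubleStandard` finishes. -/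
def ExtendsThenDouble : Prop :=
  ∀ (W : Type) [TopologicalSpace W] [ChartedSpace (EuclideanHalfSpace 4) W]
    [IsManifold (𝓡∂ 4) ∞ W] (b : BoundaryData (𝓡∂ 4) W (𝓡 3))
    (g : b.carrier ≃ₘ⟮𝓡 3, 𝓡 3⟯ b.carrier)
    (X : Type) [TopologicalSpace X] [ChartedSpace (EuclideanSpace ℝ (Fin 4)) X]
    [IsManifold (𝓡 4) ∞ X],
    IsBoundaryGluing b b g (𝓡 4) X → ExtendsToDiffeomorph b g → IsDouble b (𝓡 4) X

/-! ## Card B — planar Gram rigidity -/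

/-- **Gram rigidity (card B, first lemma; provable now, linear algebra).**  Two square
`0/1`-matrices with the same Gram matrix of columns, one of them unimodular, differ by a row
permutation.  Applied to the hole-incidence matrices of the vanishing cycles of two
ℤ-acyclic planar Lefschetz fibrations over one planar open book (rows = vanishing cycles,
columns = holes; `MᵀM` = the Plamenevskaya–Van Horn-Morris multiplicities, an invariant of the
monodromy), it says: the multiset of hole-sets enclosed by the vanishing cycles is an
invariant of the monodromy. -/
def GramRigidity : Prop :=
  ∀ (n : ℕ) (M₁ M₂ : Matrix (Fin n) (Fin n) ℤ),
    (∀ i j, M₁ i j = 0 ∨ M₁ i j = 1) → (∀ i j, M₂ i j = 0 ∨ M₂ i j = 1) →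
    IsUnit M₁.det → M₁ᵀ * M₁ = M₂ᵀ * M₂ →
    ∃ σ : Equiv.Perm (Fin n), ∀ i j, M₂ i j = M₁ (σ i) j

/-- **Residual target of card B (planar doubles).**  The double of a compact contractible Stein
domain whose contact boundary is planar is `S⁴` — the `F₁ ∼ F₂` endpoint of the card (after
Hurwitz rigidity, `X = D(X_F)`), attacked there through AC-peelability of the incidence matrix. -/
def PlanarSteinDoubleStandard : Prop :=
  ∀ (W : Type) [TopologicalSpace W] [T2Space W] [SecondCountableTopology W]
    [ChartedSpace (EuclideanHalfSpace 4) W] [IsManifold (𝓡∂ 4) ∞ W] [CompactSpace W]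
    [ContractibleSpace W] (J : SteinStructure W), PlanarContactBoundary J →
    ∀ (b : BoundaryData (𝓡∂ 4) W (𝓡 3))
      (X : Type) [TopologicalSpace X] [T2Space X] [SecondCountableTopology X] [CompactSpace X]
      [ChartedSpace (EuclideanSpace ℝ (Fin 4)) X] [IsManifold (𝓡 4) ∞ X],
      IsDouble b (𝓡 4) X → Nonempty (X ≃ₘ⟮𝓡 4, 𝓡 4⟯ 𝕊⁴)

/-- Sanity: the doubles sector is the `g = id` case of the cap-symmetry sector (statement-level
implication recorded as a Prop). -/
def DoublesFromCapSymmetry : Prop := CapSymmetryTwistStandard → SteinDoubleStandard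

/-- The crux decl this sketch serves (type-checks that the import and name are live). -/
example : Prop := Summit.SmoothPoincare4.SmoothPoincare4.Theses.ConvexBisection.ContractibleTwistedDoubleStandard

end Summit.SmoothPoincare4.SmoothPoincare4.Cruxes.ContractibleTwistedDoubleStandard.Sketch

end
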